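import Literature.Probability.Percolation.IsoradialArmComparability
import Literature.Probability.Percolation.IsoradialCriticalityProofs
import Literature.Probability.Percolation.IsoradialProofs
import HarnessLib

/-!
# Arm comparability on isoradial graphs (GM 2014, Prop. 8.1): elementary supporting lemmas

Proofs-only companion of `Literature.Probability.Percolation.IsoradialArmComparability`, which
vendors Grimmett–Manolescu, *Bond percolation on isoradial graphs: criticality and universality*,
PTRF 159 (2014) 273–327 = arXiv:1204.0505, §8.1 Prop. (exp_transport) with §8.2
Prop. (exp_equiv), for `k ∈ {1, 2}`, as the named fact
`GrimmettManolescu2014_armComparability_one_two` (call it `T`). This file consists of theorems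
only (D-0026: no new definition, no new named fact) and records what a `provefact` seat on `T`
(2026-08-15) could land.

## Status of the discharge

`T` is **not** discharged here. The printed proof (§8 of the arXiv text) is the star–triangle
transport of arm events: §8.2 Prop. (exp_equiv) (comparability of arm events under doubling /
halving of the radii and with the track-adapted events `Ã_k`, proved in §8.5 from the separation
theorem of Kesten — stated as Theorem (separation) with the words "The proof is omitted, and may
be constructed via careful readings of [Kesten87, Nolin]" — the extended Harris–FKG inequality and
the box-crossing property), §8.3 Lemma (exp_transport1) (isoradial square lattices, track
exchanges `Σ_j` of §5.3, "clusters neither break nor merge"), Cor. (exp_transport1_cor), and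
§8.4 Lemma (general graphs, grid sliding of §7 through SGP(I)). Every step uses the main Theorem
of §3, the box-crossing property BXP(δ(ε, I)) uniformly on `𝒢(ε, I)` (§8.5.1: "By Theorem (main),
`P_G` satisfies BXP(δ) with `δ = δ(ε, I)`"), which in the tree is the *unproved* named fact
`gm_boxCrossingBounds_uniform` (its faithful `(ε, I)`-form is the theorem
`gm_boxCrossingBounds_uniform.boxCrossingBounds_of_squareGridPropertyGM` of `Isoradial`). The
discharge of `T` is therefore blocked on that fact, and beyond it on a theory (track systems,
track exchanges acting on open paths, the separation theorem for isoradial graphs) absent from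
Mathlib and from `Literature`.

## Contents (all proved)

* `RhombicEmbedding.embArmEvent_inter_subset_outer`, `…_inner` and the probability forms
  `RhombicEmbedding.embArmProb_outer_anti`, `RhombicEmbedding.embArmProb_inner_mono`,
  `RhombicEmbedding.embArmProb_mono_annulus` — **the inclusion halves of Prop. (exp_equiv)
  (a), (b) in the tree's rendering**: shrinking the outer
  radius or enlarging the inner radius of the annulus enlarges the arm event
  `emb.embArmEvent κ r R` (`IsoradialPercolation`: sup-norm annulus `Λ_R ∖ Λ_r` with slack `2`,
  primal open walks / dual open walks, vertex-disjoint within each colour), for *every* colour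
  sequence `κ`, up to the null set of configurations using non-edges of `G`; hence
  `P_G[A_κ(r, R)] ≤ P_G[A_κ(r, R')]` for `r ≤ R' ≤ R` and `P_G[A_κ(r, R)] ≤ P_G[A_κ(r', R)]` for
  `r ≤ r' ≤ R`. (GM §8.2, first inequalities of the displays (a) `P[A_k(N, 2n)] ≤ P[A_k(N, n)]`
  and (b) `P[A_k(N, n)] ≤ P[A_k(2N, n)]`; the reverse inequalities are the deep halves.) Proof:
  cut each arm at its first visit to `{R' ≤ ‖·‖_∞}` (resp. restart it at its last visit to
  `{‖·‖_∞ ≤ r'}`); the slack `2` of the rendering absorbs the last (first) step because primal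
  edges (`norm_z_sub_z_lt_two`) and dual edges (`norm_c_leftFace_sub_c_rightFace_le_two`) of an
  isoradial embedding are at most `2` long. The generic cutting lemma is
  `IsoradialArmComparability.exists_walk_truncate`.
* `RhombicEmbedding.embArmProb_nonneg`, `RhombicEmbedding.embArmProb_le_one` — bookkeeping.
* `GrimmettManolescu2014_armComparability_one_two.of_oneArm_of_twoArm` — the printed constants
  are `c_i = c_i(k, ε, I)`, `N_0 = N_0(k, ε, I)` (one set per `k`); the fact `T` bundles
  `k = 1, 2` with common constants. This glue (min / max of the two sets of constants) is the
  last step of any discharge along the printed proof, converse to the projections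
  `GrimmettManolescu2014_armComparability_one_two.oneArm/twoArm` of the fact file.
* `GrimmettManolescu2014_armComparability_one_two.twoArm_le_of_mem_class` — the two-arm
  analogue of `oneArm_le_of_mem_class` (comparability of two graphs of the class through `ℤ²`),
  the form used at a two-phase seam by the consumer route.

## References

* G. R. Grimmett, I. Manolescu, *Bond percolation on isoradial graphs: criticality and
  universality*, PTRF 159 (2014) 273–327, arXiv:1204.0505: §3 (arm events `A_σ(N, n)`), §8.1
  Prop. (exp_transport), §8.2 Prop. (exp_equiv) (a), (b), §8.3–8.5 (proof structure; Theorem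
  (separation), proof omitted there), §4.4 (edge lengths `< 2`).
* H. Kesten, *Scaling relations for 2D-percolation*, Comm. Math. Phys. 109 (1987) 109–156
  (separation theorem); P. Nolin, *Near-critical percolation in two dimensions*, EJP 13 (2008).
-/

noncomputable section

open MeasureTheory

namespace Literature.Probability.Percolation

open LatticeModels Percolation

/-! ### Cutting a walk at the first visit to a super-level set of a height function -/

namespace IsoradialArmComparability

/-- **First-visit truncation.** Let `f` be a real height function on the vertices of a graph `H`
that increases by at most `2` along every edge. A walk from `u` with `f u ≤ t + 2` to a vertex
of height `≥ t` has an initial segment (as a walk `q` from `u`, with `q.support ⊆ p.support`)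
ending at a vertex of height `≥ t` all of whose vertices have height `≤ t + 2`: stop at the
first vertex of height `≥ t`; its predecessor has height `< t`. (Last-exit / first-entrance
decomposition of paths, as used throughout Grimmett–Manolescu 2014, §8.5.2; elementary.)
[folklore] -/
theorem exists_walk_truncate {W : Type*} {H : SimpleGraph W} (f : W → ℝ) (t : ℝ)
    (hf : ∀ ⦃a b : W⦄, H.Adj a b → f b ≤ f a + 2) :
    ∀ {u v : W} (p : H.Walk u v), f u ≤ t + 2 → t ≤ f v →
      ∃ (v' : W) (q : H.Walk u v'), t ≤ f v' ∧ (∀ y ∈ q.support, y ∈ p.support) ∧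
        ∀ y ∈ q.support, f y ≤ t + 2 := by
  intro u v p
  induction p with
  | nil =>
    intro hu hv
    exact ⟨_, SimpleGraph.Walk.nil, hv, fun y hy => hy, fun y hy => by
      rw [SimpleGraph.Walk.support_nil, List.mem_singleton] at hy
      rw [hy]; exact hu⟩
  | @cons a b c h p ih =>
    intro hu hv
    by_cases ha : t ≤ f a
    · refine ⟨a, SimpleGraph.Walk.nil, ha, fun y hy => ?_, fun y hy => ?_⟩
      · rw [SimpleGraph.Walk.support_nil, List.mem_singleton] at hy
        rw [hy]; exact SimpleGraph.Walk.start_mem_support _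
      · rw [SimpleGraph.Walk.support_nil, List.mem_singleton] at hy
        rw [hy]; exact hu
    · push Not at ha
      have hb : f b ≤ t + 2 := by linarith [hf h]
      obtain ⟨v', q, h1, h2, h3⟩ := ih hb hv
      refine ⟨v', SimpleGraph.Walk.cons h q, h1, fun y hy => ?_, fun y hy => ?_⟩
      · rw [SimpleGraph.Walk.support_cons, List.mem_cons] at hy ⊢
        exact hy.imp id (h2 y)
      · rw [SimpleGraph.Walk.support_cons, List.mem_cons] at hy
        rcases hy with rfl | hy
        · linarith
        · exact h3 y hy

end IsoradialArmComparability

open IsoradialArmComparability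

/-! ### Edge lengths: one step of a primal or dual open walk moves the sup norm by at most `2` -/

section Steps

variable {V F : Type*} {G : SimpleGraph V} (emb : RhombicEmbedding G F)

/-- **Dual edges of an isoradial embedding are at most `2` long**: the centres of the two faces
of a dart are both at distance `1` from its tail (`IsIsoradial.norm_sub_eq_one` for `d` and for
`d.symm`, with `leftFace d.symm = rightFace d`). (Grimmett–Manolescu 2014, §2.1, the rhombus
`A O₁ B O₂`; §4.4.) [cite: GrimmettManolescu2014Isoradial, §2.1 (rhombus A O₁ B O₂) and §4.4] -/
theorem _root_.Literature.Probability.LatticeModels.RhombicEmbedding.norm_c_leftFace_sub_c_rightFace_le_two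
    (hiso : emb.IsIsoradial) (d : G.Dart) :
    ‖emb.c (emb.leftFace d) - emb.c (emb.rightFace d)‖ ≤ 2 := by
  obtain ⟨h1, -⟩ := hiso.norm_sub_eq_one d
  obtain ⟨-, h2⟩ := hiso.norm_sub_eq_one d.symm
  rw [hiso.leftFace_symm] at h2
  have h2' : ‖emb.z d.fst - emb.c (emb.rightFace d)‖ = 1 := h2
  calc ‖emb.c (emb.leftFace d) - emb.c (emb.rightFace d)‖
      = ‖(emb.c (emb.leftFace d) - emb.z d.fst) + (emb.z d.fst - emb.c (emb.rightFace d))‖ := by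
        congr 1; ring
    _ ≤ ‖emb.c (emb.leftFace d) - emb.z d.fst‖ + ‖emb.z d.fst - emb.c (emb.rightFace d)‖ :=
        norm_add_le _ _
    _ = 2 := by rw [norm_sub_rev, h1, h2']; norm_num

/-- Along an open edge of a configuration using only edges of `G`, the sup norm of the position
increases by at most `2` (edges of an isoradial graph are shorter than `2`,
`norm_z_sub_z_lt_two`). [cite: GrimmettManolescu2014Isoradial, §4.4 (edge lengths)] -/
theorem _root_.Literature.Probability.LatticeModels.RhombicEmbedding.boxNorm_z_le_of_openGraph_adj
    (hiso : emb.IsIsoradial) {ω : BondConfig V} (hω : ω ⊆ G.edgeSet) ⦃a b : V⦄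
    (h : (openGraph ω).Adj a b) : (emb.z b).boxNorm ≤ (emb.z a).boxNorm + 2 := by
  rw [openGraph_adj] at h
  have hadj : G.Adj a b := hω h.1
  have hlt := IsoradialCriticality.norm_z_sub_z_lt_two hiso ⟨(a, b), hadj⟩
  have heq : emb.z b = emb.z a + (emb.z b - emb.z a) := by ring
  have hle : (emb.z b).boxNorm ≤ (emb.z a).boxNorm + (emb.z b - emb.z a).boxNorm := by
    have := IsoradialCriticality.boxNorm_add_le (emb.z a) (emb.z b - emb.z a)
    rwa [← heq] at this
  have hn : (emb.z b - emb.z a).boxNorm ≤ ‖emb.z a - emb.z b‖ := by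
    rw [norm_sub_rev]; exact IsoradialCriticality.boxNorm_le_norm _
  have hlt' : ‖emb.z (⟨(a, b), hadj⟩ : G.Dart).fst - emb.z (⟨(a, b), hadj⟩ : G.Dart).snd‖
      = ‖emb.z a - emb.z b‖ := rfl
  linarith

/-- Along a dual-open edge, the sup norm of the face centre increases by at most `2`
(`norm_c_leftFace_sub_c_rightFace_le_two`; no condition on the configuration, dual adjacency
being read off darts of `G`). [cite: GrimmettManolescu2014Isoradial, §2.1 and §4.4] -/
theorem _root_.Literature.Probability.LatticeModels.RhombicEmbedding.boxNorm_c_le_of_dualOpenGraph_adj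
    (hiso : emb.IsIsoradial) {ω : BondConfig V} ⦃f g : F⦄
    (h : (emb.dualOpenGraph ω).Adj f g) : (emb.c g).boxNorm ≤ (emb.c f).boxNorm + 2 := by
  have key : ‖emb.c f - emb.c g‖ ≤ 2 := by
    rw [RhombicEmbedding.dualOpenGraph, SimpleGraph.fromRel_adj] at h
    obtain ⟨-, ⟨d, rfl, rfl, -⟩ | ⟨d, rfl, rfl, -⟩⟩ := h
    · exact emb.norm_c_leftFace_sub_c_rightFace_le_two hiso d
    · rw [norm_sub_rev]; exact emb.norm_c_leftFace_sub_c_rightFace_le_two hiso d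
  have heq : emb.c g = emb.c f + (emb.c g - emb.c f) := by ring
  have hle : (emb.c g).boxNorm ≤ (emb.c f).boxNorm + (emb.c g - emb.c f).boxNorm := by
    have := IsoradialCriticality.boxNorm_add_le (emb.c f) (emb.c g - emb.c f)
    rwa [← heq] at this
  have hn : (emb.c g - emb.c f).boxNorm ≤ ‖emb.c f - emb.c g‖ := by
    rw [norm_sub_rev]; exact IsoradialCriticality.boxNorm_le_norm _
  linarith

end Steps

/-! ### Monotonicity of the arm events in the radii (GM §8.2, (a)–(b), inclusion halves) -/

section Monotone

variable {V F : Type*} {G : SimpleGraph V} (emb : RhombicEmbedding G F)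

/-- **Shrinking the outer radius enlarges the arm event** (up to configurations using non-edges
of `G`): for `r ≤ R' ≤ R`, `A_κ(r, R) ∩ {ω ⊆ E(G)} ⊆ A_κ(r, R')` for the tree's arm events
`embArmEvent` and every colour sequence `κ`. Each primal (dual) arm is cut at its first vertex of
sup norm `≥ R'`; that vertex has sup norm `≤ R' + 2` because one open (dual-open) step moves the
sup norm by at most `2`, and vertex-disjointness within each colour passes to sub-walks. This is
the inclusion `A_k(N, 2n) ⊆ A_k(N, n)` behind the first inequality of Grimmett–Manolescu's
Prop. (exp_equiv) (a), in the slack-`2` rendering.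
[cite: GrimmettManolescu2014Isoradial, §8.2 Prop. (exp_equiv) (a), first inequality] -/
theorem _root_.Literature.Probability.LatticeModels.RhombicEmbedding.embArmEvent_inter_subset_outer
    (hiso : emb.IsIsoradial) {k : ℕ} (κ : Fin k → Bool) {r R' R : ℕ} (hrR' : r ≤ R')
    (hR'R : R' ≤ R) :
    emb.embArmEvent κ r R ∩ {ω | ω ⊆ G.edgeSet} ⊆ emb.embArmEvent κ r R' := by
  intro ω hω
  obtain ⟨hω, hgood⟩ := hω
  have hgood' : ω ⊆ G.edgeSet := hgood
  simp only [RhombicEmbedding.embArmEvent, Set.mem_setOf_eq] at hω ⊢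
  obtain ⟨x, y, w, f, g, w', hprim, hdual, hdisjP, hdisjD⟩ := hω
  have hrR'ℝ : (r : ℝ) ≤ R' := by exact_mod_cast hrR'
  have hR'Rℝ : (R' : ℝ) ≤ R := by exact_mod_cast hR'R
  -- primal arms, cut at the first visit to `{R' ≤ ‖·‖_∞}`
  have keyP : ∀ j, ∃ (y' : V) (q : (openGraph ω).Walk (x j) y'),
      (∀ v ∈ q.support, v ∈ (w j).support) ∧
      (κ j = true → (R' : ℝ) ≤ (emb.z y').boxNorm ∧
        ∀ v ∈ q.support, (emb.z v).boxNorm ≤ (R' : ℝ) + 2) := by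
    intro j
    by_cases hj : κ j = true
    · obtain ⟨hx, hy, -⟩ := hprim j hj
      obtain ⟨y', q, h1, h2, h3⟩ := exists_walk_truncate (fun v => (emb.z v).boxNorm) (R' : ℝ)
        (fun a b hab => emb.boxNorm_z_le_of_openGraph_adj hiso hgood' hab) (w j)
        (by linarith) (hR'Rℝ.trans hy)
      exact ⟨y', q, h2, fun _ => ⟨h1, h3⟩⟩
    · exact ⟨y j, w j, fun v hv => hv, fun h => absurd h hj⟩
  choose y' q hq using keyP
  -- dual arms, likewise
  have keyD : ∀ j, ∃ (g' : F) (q' : (emb.dualOpenGraph ω).Walk (f j) g'),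
      (∀ v ∈ q'.support, v ∈ (w' j).support) ∧
      (κ j = false → (R' : ℝ) ≤ (emb.c g').boxNorm ∧
        ∀ v ∈ q'.support, (emb.c v).boxNorm ≤ (R' : ℝ) + 2) := by
    intro j
    by_cases hj : κ j = false
    · obtain ⟨hx, hy, -⟩ := hdual j hj
      obtain ⟨g', q', h1, h2, h3⟩ := exists_walk_truncate (fun v => (emb.c v).boxNorm) (R' : ℝ)
        (fun a b hab => emb.boxNorm_c_le_of_dualOpenGraph_adj hiso hab) (w' j)
        (by linarith) (hR'Rℝ.trans hy)
      exact ⟨g', q', h2, fun _ => ⟨h1, h3⟩⟩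
    · exact ⟨g j, w' j, fun v hv => hv, fun h => absurd h hj⟩
  choose g' q' hq' using keyD
  refine ⟨x, y', q, f, g', q', fun j hj => ?_, fun j hj => ?_, fun i j hij hi hj => ?_,
    fun i j hij hi hj => ?_⟩
  · obtain ⟨hx, -, hsupp⟩ := hprim j hj
    obtain ⟨hR', hup⟩ := (hq j).2 hj
    exact ⟨hx, hR', fun v hv => ⟨(hsupp v ((hq j).1 v hv)).1, hup v hv⟩⟩
  · obtain ⟨hx, -, hsupp⟩ := hdual j hj
    obtain ⟨hR', hup⟩ := (hq' j).2 hj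
    exact ⟨hx, hR', fun v hv => ⟨(hsupp v ((hq' j).1 v hv)).1, hup v hv⟩⟩
  · exact (hdisjP hij hi hj).mono (fun v hv => (hq i).1 v hv) (fun v hv => (hq j).1 v hv)
  · exact (hdisjD hij hi hj).mono (fun v hv => (hq' i).1 v hv) (fun v hv => (hq' j).1 v hv)

/-- **Enlarging the inner radius enlarges the arm event** (up to configurations using non-edges
of `G`): for `r ≤ r' ≤ R`, `A_κ(r, R) ∩ {ω ⊆ E(G)} ⊆ A_κ(r', R)`. Each arm is restarted at its
last vertex of sup norm `≤ r'` (first-visit truncation of the reversed walk for the height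
`-‖·‖_∞`); that vertex has sup norm `≥ r' - 2`. This is the inclusion `A_k(N, n) ⊆ A_k(2N, n)`
behind the first inequality of Grimmett–Manolescu's Prop. (exp_equiv) (b), in the slack-`2`
rendering. [cite: GrimmettManolescu2014Isoradial, §8.2 Prop. (exp_equiv) (b), first inequality] -/
theorem _root_.Literature.Probability.LatticeModels.RhombicEmbedding.embArmEvent_inter_subset_inner
    (hiso : emb.IsIsoradial) {k : ℕ} (κ : Fin k → Bool) {r r' R : ℕ} (hrr' : r ≤ r')
    (hr'R : r' ≤ R) :
    emb.embArmEvent κ r R ∩ {ω | ω ⊆ G.edgeSet} ⊆ emb.embArmEvent κ r' R := by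
  intro ω hω
  obtain ⟨hω, hgood⟩ := hω
  have hgood' : ω ⊆ G.edgeSet := hgood
  simp only [RhombicEmbedding.embArmEvent, Set.mem_setOf_eq] at hω ⊢
  obtain ⟨x, y, w, f, g, w', hprim, hdual, hdisjP, hdisjD⟩ := hω
  have hrr'ℝ : (r : ℝ) ≤ r' := by exact_mod_cast hrr'
  have hr'Rℝ : (r' : ℝ) ≤ R := by exact_mod_cast hr'R
  -- primal arms, restarted at the last visit to `{‖·‖_∞ ≤ r'}`
  have keyP : ∀ j, ∃ (x' : V) (q : (openGraph ω).Walk x' (y j)),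
      (∀ v ∈ q.support, v ∈ (w j).support) ∧
      (κ j = true → (emb.z x').boxNorm ≤ (r' : ℝ) ∧
        ∀ v ∈ q.support, (r' : ℝ) - 2 ≤ (emb.z v).boxNorm) := by
    intro j
    by_cases hj : κ j = true
    · obtain ⟨hx, hy, -⟩ := hprim j hj
      obtain ⟨x', q, h1, h2, h3⟩ := exists_walk_truncate (fun v => -(emb.z v).boxNorm) (-(r' : ℝ))
        (fun a b hab => by
          have := emb.boxNorm_z_le_of_openGraph_adj hiso hgood' hab.symm
          linarith) (w j).reverse (by linarith) (by linarith)
      refine ⟨x', q.reverse, fun v hv => ?_, fun _ => ⟨by linarith, fun v hv => ?_⟩⟩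
      · rw [SimpleGraph.Walk.support_reverse, List.mem_reverse] at hv
        have := h2 v hv
        rwa [SimpleGraph.Walk.support_reverse, List.mem_reverse] at this
      · rw [SimpleGraph.Walk.support_reverse, List.mem_reverse] at hv
        have := h3 v hv
        linarith
    · exact ⟨x j, w j, fun v hv => hv, fun h => absurd h hj⟩
  choose x' q hq using keyP
  -- dual arms, likewise
  have keyD : ∀ j, ∃ (f' : F) (q' : (emb.dualOpenGraph ω).Walk f' (g j)),
      (∀ v ∈ q'.support, v ∈ (w' j).support) ∧
      (κ j = false → (emb.c f').boxNorm ≤ (r' : ℝ) ∧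
        ∀ v ∈ q'.support, (r' : ℝ) - 2 ≤ (emb.c v).boxNorm) := by
    intro j
    by_cases hj : κ j = false
    · obtain ⟨hx, hy, -⟩ := hdual j hj
      obtain ⟨f', q', h1, h2, h3⟩ := exists_walk_truncate (fun v => -(emb.c v).boxNorm) (-(r' : ℝ))
        (fun a b hab => by
          have := emb.boxNorm_c_le_of_dualOpenGraph_adj hiso hab.symm
          linarith) (w' j).reverse (by linarith) (by linarith)
      refine ⟨f', q'.reverse, fun v hv => ?_, fun _ => ⟨by linarith, fun v hv => ?_⟩⟩
      · rw [SimpleGraph.Walk.support_reverse, List.mem_reverse] at hv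
        have := h2 v hv
        rwa [SimpleGraph.Walk.support_reverse, List.mem_reverse] at this
      · rw [SimpleGraph.Walk.support_reverse, List.mem_reverse] at hv
        have := h3 v hv
        linarith
    · exact ⟨f j, w' j, fun v hv => hv, fun h => absurd h hj⟩
  choose f' q' hq' using keyD
  refine ⟨x', y, q, f', g, q', fun j hj => ?_, fun j hj => ?_, fun i j hij hi hj => ?_,
    fun i j hij hi hj => ?_⟩
  · obtain ⟨-, hy, hsupp⟩ := hprim j hj
    obtain ⟨hr', hlow⟩ := (hq j).2 hj
    exact ⟨hr', hy, fun v hv => ⟨hlow v hv, (hsupp v ((hq j).1 v hv)).2⟩⟩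
  · obtain ⟨-, hy, hsupp⟩ := hdual j hj
    obtain ⟨hr', hlow⟩ := (hq' j).2 hj
    exact ⟨hr', hy, fun v hv => ⟨hlow v hv, (hsupp v ((hq' j).1 v hv)).2⟩⟩
  · exact (hdisjP hij hi hj).mono (fun v hv => (hq i).1 v hv) (fun v hv => (hq j).1 v hv)
  · exact (hdisjD hij hi hj).mono (fun v hv => (hq' i).1 v hv) (fun v hv => (hq' j).1 v hv)

/-- Inclusion up to the null set of configurations using non-edges of `G` gives an inequality
of probabilities under the canonical measure (`isoradialPercolation_not_subset_edgeSet`: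
non-edges have weight `0`). [cite: GrimmettManolescu2014Isoradial, §2.2 (P_G is a product measure on {0,1}^E)] -/
theorem _root_.Literature.Probability.LatticeModels.RhombicEmbedding.real_le_real_of_inter_subset
    [Countable V] {E₁ E₂ : Set (BondConfig V)} (h : E₁ ∩ {ω | ω ⊆ G.edgeSet} ⊆ E₂) :
    emb.isoradialPercolation.real E₁ ≤ emb.isoradialPercolation.real E₂ := by
  have hbad : emb.isoradialPercolation.real {ω : BondConfig V | ¬ ω ⊆ G.edgeSet} = 0 :=
    (measureReal_eq_zero_iff).2
      (IsoradialCriticality.isoradialPercolation_not_subset_edgeSet emb)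
  calc emb.isoradialPercolation.real E₁
      ≤ emb.isoradialPercolation.real
          (E₁ ∩ {ω | ω ⊆ G.edgeSet} ∪ {ω : BondConfig V | ¬ ω ⊆ G.edgeSet}) :=
        measureReal_mono (fun ω hω => by
          by_cases hg : ω ⊆ G.edgeSet
          · exact Or.inl ⟨hω, hg⟩
          · exact Or.inr hg)
    _ ≤ emb.isoradialPercolation.real (E₁ ∩ {ω | ω ⊆ G.edgeSet}) +
          emb.isoradialPercolation.real {ω : BondConfig V | ¬ ω ⊆ G.edgeSet} :=
        measureReal_union_le _ _
    _ = emb.isoradialPercolation.real (E₁ ∩ {ω | ω ⊆ G.edgeSet}) := by rw [hbad, add_zero]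
    _ ≤ emb.isoradialPercolation.real E₂ := measureReal_mono h

/-- Arm probabilities are nonnegative. [folklore] -/
theorem _root_.Literature.Probability.LatticeModels.RhombicEmbedding.embArmProb_nonneg
    {k : ℕ} (κ : Fin k → Bool) (r R : ℕ) : 0 ≤ emb.embArmProb κ r R :=
  measureReal_nonneg

/-- Arm probabilities are at most `1`. [folklore] -/
theorem _root_.Literature.Probability.LatticeModels.RhombicEmbedding.embArmProb_le_one
    {k : ℕ} (κ : Fin k → Bool) (r R : ℕ) : emb.embArmProb κ r R ≤ 1 :=
  measureReal_le_one

/-- **`P_G[A_κ(r, R)]` is antitone in the outer radius**: for `r ≤ R' ≤ R`,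
`P_G[A_κ(r, R)] ≤ P_G[A_κ(r, R')]` — the first inequality of Grimmett–Manolescu's
Prop. (exp_equiv) (a), `P[A_k(N, 2n)] ≤ P[A_k(N, n)]`, for the tree's arm events and every
colour sequence. [cite: GrimmettManolescu2014Isoradial, §8.2 Prop. (exp_equiv) (a), first inequality] -/
theorem _root_.Literature.Probability.LatticeModels.RhombicEmbedding.embArmProb_outer_anti
    [Countable V] (hiso : emb.IsIsoradial) {k : ℕ} (κ : Fin k → Bool) {r R' R : ℕ}
    (hrR' : r ≤ R') (hR'R : R' ≤ R) : emb.embArmProb κ r R ≤ emb.embArmProb κ r R' :=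
  emb.real_le_real_of_inter_subset (emb.embArmEvent_inter_subset_outer hiso κ hrR' hR'R)

/-- **`P_G[A_κ(r, R)]` is monotone in the inner radius**: for `r ≤ r' ≤ R`,
`P_G[A_κ(r, R)] ≤ P_G[A_κ(r', R)]` — the first inequality of Grimmett–Manolescu's
Prop. (exp_equiv) (b), `P[A_k(N, n)] ≤ P[A_k(2N, n)]`, for the tree's arm events and every
colour sequence. [cite: GrimmettManolescu2014Isoradial, §8.2 Prop. (exp_equiv) (b), first inequality] -/
theorem _root_.Literature.Probability.LatticeModels.RhombicEmbedding.embArmProb_inner_mono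
    [Countable V] (hiso : emb.IsIsoradial) {k : ℕ} (κ : Fin k → Bool) {r r' R : ℕ}
    (hrr' : r ≤ r') (hr'R : r' ≤ R) : emb.embArmProb κ r R ≤ emb.embArmProb κ r' R :=
  emb.real_le_real_of_inter_subset (emb.embArmEvent_inter_subset_inner hiso κ hrr' hr'R)

/-- **Shrinking the annulus from both sides increases the arm probability**: for
`r ≤ r' ≤ R' ≤ R`, `P_G[A_κ(r, R)] ≤ P_G[A_κ(r', R')]` (the two monotonicities combined; the
form in which the inclusion halves of Prop. (exp_equiv) (a), (b) are "iterated" in §8.3–8.4).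
[cite: GrimmettManolescu2014Isoradial, §8.2 Prop. (exp_equiv) (a)–(b), first inequalities] -/
theorem _root_.Literature.Probability.LatticeModels.RhombicEmbedding.embArmProb_mono_annulus
    [Countable V] (hiso : emb.IsIsoradial) {k : ℕ} (κ : Fin k → Bool) {r r' R' R : ℕ}
    (hrr' : r ≤ r') (hr'R' : r' ≤ R') (hR'R : R' ≤ R) :
    emb.embArmProb κ r R ≤ emb.embArmProb κ r' R' :=
  (emb.embArmProb_outer_anti hiso κ (hrr'.trans hr'R') hR'R).trans
    (emb.embArmProb_inner_mono hiso κ hrr' hr'R')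

end Monotone

/-! ### Glue for the named fact: per-`k` constants, and the two-arm seam corollary -/

namespace GrimmettManolescu2014_armComparability_one_two

/-- **The fact follows from its two halves with separate constants.** Grimmett–Manolescu's
constants are `c_i = c_i(k, ε, I) > 0`, `N_0 = N_0(k, ε, I)`, one set for each number `k` of
arms (§8.1: "constants `c_i > 0`, `N_0 ∈ ℕ` depend only on `ε`, `I`, and on the number `k` of
arms"); the fact `GrimmettManolescu2014_armComparability_one_two` quantifies one common set for
`k ∈ {1, 2}`. Taking `min` of the lower constants and `max` of the upper constants, of the `c₀`
and of the `N₀` reconciles the two (arm probabilities being nonnegative). This is the converse of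
the projections `oneArm`, `twoArm`. [cite: GrimmettManolescu2014Isoradial, §8.1 Prop. (exp_transport), constants c_i(k, ε, I)] -/
theorem of_oneArm_of_twoArm
    (h₁ : ∀ (ε : ℝ), 0 < ε → ∀ (I : ℕ), ∃ c₁ > (0 : ℝ), ∃ c₂ > (0 : ℝ), ∃ c₀ : ℕ, 1 ≤ c₀ ∧ ∃ N₀ : ℕ,
      ∀ (V F : Type) [Countable V] [DecidableEq V] [DecidableEq F] (G : SimpleGraph V)
        [G.LocallyFinite] (emb : RhombicEmbedding G F),
        G.Preconnected → emb.IsIsoradial → emb.IsRhombicTiling → emb.HasBoundedAngles ε →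
        emb.SquareGridPropertyGM I → ((∃ v : V, emb.z v = 0) ∨ (∃ f : F, emb.c f = 0)) →
        ∀ N n : ℕ, N₀ ≤ N → c₀ * N ≤ n →
          c₁ * squareLatticeEmbedding.embArmProb oneArmColour N n ≤ emb.embArmProb oneArmColour N n ∧
            emb.embArmProb oneArmColour N n ≤
              c₂ * squareLatticeEmbedding.embArmProb oneArmColour N n)
    (h₂ : ∀ (ε : ℝ), 0 < ε → ∀ (I : ℕ), ∃ c₁ > (0 : ℝ), ∃ c₂ > (0 : ℝ), ∃ c₀ : ℕ, 1 ≤ c₀ ∧ ∃ N₀ : ℕ,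
      ∀ (V F : Type) [Countable V] [DecidableEq V] [DecidableEq F] (G : SimpleGraph V)
        [G.LocallyFinite] (emb : RhombicEmbedding G F),
        G.Preconnected → emb.IsIsoradial → emb.IsRhombicTiling → emb.HasBoundedAngles ε →
        emb.SquareGridPropertyGM I → ((∃ v : V, emb.z v = 0) ∨ (∃ f : F, emb.c f = 0)) →
        ∀ N n : ℕ, N₀ ≤ N → c₀ * N ≤ n →
          c₁ * squareLatticeEmbedding.embArmProb (alternatingColours 1) N n ≤
              emb.embArmProb (alternatingColours 1) N n ∧
            emb.embArmProb (alternatingColours 1) N n ≤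
              c₂ * squareLatticeEmbedding.embArmProb (alternatingColours 1) N n) :
    GrimmettManolescu2014_armComparability_one_two := by
  intro ε hε I
  obtain ⟨a₁, ha₁, a₂, ha₂, a₀, ha₀, A₀, H₁⟩ := h₁ ε hε I
  obtain ⟨b₁, hb₁, b₂, -, b₀, -, B₀, H₂⟩ := h₂ ε hε I
  refine ⟨min a₁ b₁, lt_min ha₁ hb₁, max a₂ b₂, lt_max_of_lt_left ha₂, max a₀ b₀,
    le_max_of_le_left ha₀, max A₀ B₀, ?_⟩
  intro V F _ _ _ G _ emb hconn hiso hrh hbap hsgp h0 N n hN hn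
  have hN₁ : A₀ ≤ N := (le_max_left _ _).trans hN
  have hN₂ : B₀ ≤ N := (le_max_right _ _).trans hN
  have hn₁ : a₀ * N ≤ n := (Nat.mul_le_mul_right N (le_max_left _ _)).trans hn
  have hn₂ : b₀ * N ≤ n := (Nat.mul_le_mul_right N (le_max_right _ _)).trans hn
  obtain ⟨h1l, h1u⟩ := H₁ V F G emb hconn hiso hrh hbap hsgp h0 N n hN₁ hn₁
  obtain ⟨h2l, h2u⟩ := H₂ V F G emb hconn hiso hrh hbap hsgp h0 N n hN₂ hn₂
  have hsq₁ := squareLatticeEmbedding.embArmProb_nonneg oneArmColour N n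
  have hsq₂ := squareLatticeEmbedding.embArmProb_nonneg (alternatingColours 1) N n
  refine ⟨⟨?_, ?_⟩, ?_, ?_⟩
  · exact (mul_le_mul_of_nonneg_right (min_le_left _ _) hsq₁).trans h1l
  · exact h1u.trans (mul_le_mul_of_nonneg_right (le_max_left _ _) hsq₁)
  · exact (mul_le_mul_of_nonneg_right (min_le_right _ _) hsq₂).trans h2l
  · exact h2u.trans (mul_le_mul_of_nonneg_right (le_max_right _ _) hsq₂)

/-- **Two-arm comparability of two graphs of the class** (transitivity through `ℤ²`): for
`G, G' ∈ 𝒢(ε, I)`, each with a primal or dual vertex at the origin,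
`P_G[A₂(N, n)] ≤ (c₂/c₁) P_{G'}[A₂(N, n)]` for `N ≥ N₀`, `n ≥ c₀ N` — the two-arm analogue of
`oneArm_le_of_mem_class`, the form used across a two-phase seam.
[cite: GrimmettManolescu2014Isoradial, §8.1 Prop. (exp_transport) (k = 2)] -/
theorem twoArm_le_of_mem_class (h : GrimmettManolescu2014_armComparability_one_two) {ε : ℝ}
    (hε : 0 < ε) (I : ℕ) :
    ∃ C > (0 : ℝ), ∃ c₀ : ℕ, 1 ≤ c₀ ∧ ∃ N₀ : ℕ,
      ∀ (V F : Type) [Countable V] [DecidableEq V] [DecidableEq F] (G : SimpleGraph V)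
        [G.LocallyFinite] (emb : RhombicEmbedding G F)
        (V' F' : Type) [Countable V'] [DecidableEq V'] [DecidableEq F'] (G' : SimpleGraph V')
        [G'.LocallyFinite] (emb' : RhombicEmbedding G' F'),
        G.Preconnected → emb.IsIsoradial → emb.IsRhombicTiling → emb.HasBoundedAngles ε →
        emb.SquareGridPropertyGM I → ((∃ v : V, emb.z v = 0) ∨ (∃ f : F, emb.c f = 0)) →
        G'.Preconnected → emb'.IsIsoradial → emb'.IsRhombicTiling → emb'.HasBoundedAngles ε →
        emb'.SquareGridPropertyGM I → ((∃ v : V', emb'.z v = 0) ∨ (∃ f : F', emb'.c f = 0)) →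
        ∀ N n : ℕ, N₀ ≤ N → c₀ * N ≤ n →
          emb.embArmProb (alternatingColours 1) N n ≤
            C * emb'.embArmProb (alternatingColours 1) N n := by
  obtain ⟨c₁, hc₁, c₂, hc₂, c₀, hc₀, N₀, H⟩ := h.twoArm hε I
  refine ⟨c₂ / c₁, by positivity, c₀, hc₀, N₀, ?_⟩
  intro V F _ _ _ G _ emb V' F' _ _ _ G' _ emb' hconn hiso hrh hbap hsgp h0 hconn' hiso' hrh' hbap' hsgp'
    h0' N n hN hn
  obtain ⟨-, h2⟩ := H V F G emb hconn hiso hrh hbap hsgp h0 N n hN hn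
  obtain ⟨h1', -⟩ := H V' F' G' emb' hconn' hiso' hrh' hbap' hsgp' h0' N n hN hn
  have hsq : squareLatticeEmbedding.embArmProb (alternatingColours 1) N n ≤
      emb'.embArmProb (alternatingColours 1) N n / c₁ := by
    rw [le_div_iff₀ hc₁, mul_comm]; exact h1'
  calc emb.embArmProb (alternatingColours 1) N n
      ≤ c₂ * squareLatticeEmbedding.embArmProb (alternatingColours 1) N n := h2
    _ ≤ c₂ * (emb'.embArmProb (alternatingColours 1) N n / c₁) :=
        mul_le_mul_of_nonneg_left hsq hc₂.le
    _ = c₂ / c₁ * emb'.embArmProb (alternatingColours 1) N n := by ring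


/-! ### Reduction to pairwise comparability inside the class (GM §8.3 Cor. and §8.4, last step)

Grimmett–Manolescu prove Prop. (exp_transport) by comparing an arbitrary `G ∈ 𝒢(ε, I)` with an
isoradial square lattice (§8.4, Lemma (exp_transport2)) and two isoradial square lattices with
each other (§8.3, Lemma (exp_transport1) and its Corollary: "for any `G_{α,β} ∈ 𝒢(ε, I)`,
`c₁ P_{0,π/2}[A_k] ≤ P_{α,β}[A_k] ≤ c₂ P_{0,π/2}[A_k]`", obtained by applying the lemma twice
through an intermediate lattice) — i.e. the printed argument delivers *pairwise* comparability of
the members of `𝒢(ε, I)` with constants depending on `(k, ε, I)` only, and the reference lattice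
`G_{0,π/2}` enters only as a member of the class. The tree's reference lattice
`squareLatticeEmbedding` (`√2 ℤ²`, axis-parallel, i.e. `G_{0,π/2}` rotated by `π/4`) is a member
of `𝒢(ε', I')` for `ε' ≤ π/4`, `I' ≥ 1` (`hasBoundedAngles_squareLatticeEmbedding_holds`,
`squareGridPropertyGM_squareLattice`, `isIsoradial_squareLatticeEmbedding_holds`,
`isRhombicTiling_squareLatticeEmbedding_holds`, `zdGraph_preconnected_holds`,
`squareLatticeEmbedding_z_zero`), and the classes are monotone
(`HasBoundedAngles.anti`, `SquareGridPropertyGM.mono`), so pairwise comparability inside every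
class `𝒢(ε, I)` yields the fact, with `c₁ = C(ε ⊓ π/4, I ⊔ 1)⁻¹`, `c₂ = C(ε ⊓ π/4, I ⊔ 1)`.
-/

section ClassMonotone

variable {V F : Type*} {G : SimpleGraph V} {emb : RhombicEmbedding G F}

/-- **BAP(ε) implies BAP(ε') for `ε' ≤ ε`** (the classes `𝒢(ε, I)` decrease in `ε`; immediate
from the definition `halfAngle ∈ [ε, π/2 - ε]`). [cite: GrimmettManolescu2014Isoradial, §2.1 Def. (BAP(ε))] -/
theorem _root_.Literature.Probability.LatticeModels.RhombicEmbedding.HasBoundedAngles.anti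
    {ε ε' : ℝ} (h : emb.HasBoundedAngles ε) (hle : ε' ≤ ε) : emb.HasBoundedAngles ε' :=
  fun d => ⟨hle.trans (h d).1, (h d).2.trans (by linarith)⟩

/-- **SGP(I) implies SGP(J) for `I ≤ J`** (the classes `𝒢(ε, I)` increase in `I`; clause (c) of
§4.2 is a strict upper bound `< I` on the number of track-intersections, `IsSquareGridGM.mono`).
[cite: GrimmettManolescu2014Isoradial, §4.2 (SGP(I), clause (c))] -/
theorem _root_.Literature.Probability.LatticeModels.RhombicEmbedding.SquareGridPropertyGM.mono
    [DecidableEq V] [DecidableEq F] {I J : ℕ} (h : emb.SquareGridPropertyGM I) (hIJ : I ≤ J) :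
    emb.SquareGridPropertyGM J := by
  obtain ⟨s, t, hst⟩ := h
  exact ⟨s, t, hst.mono hIJ⟩

end ClassMonotone

/-- **Pairwise comparability inside the classes gives comparability with `ℤ²`**, for any colour
sequence `κ`: if for every `ε > 0`, `I` there are `C > 0`, `c₀ ≥ 1`, `N₀` with
`P_G[A_κ(N, n)] ≤ C · P_{G'}[A_κ(N, n)]` for all `G, G' ∈ 𝒢(ε, I)` with a primal or dual vertex
at the origin and all `N ≥ N₀`, `n ≥ c₀ N`, then for every `ε > 0`, `I` there are `c₁, c₂ > 0`,
`c₀ ≥ 1`, `N₀` with `c₁ P_{ℤ²}[A_κ] ≤ P_G[A_κ] ≤ c₂ P_{ℤ²}[A_κ]` on the same range — apply the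
hypothesis in the class `𝒢(ε ⊓ π/4, I ⊔ 1)`, which contains both `𝒢(ε, I)` and the square
lattice. This is the way the reference lattice `G_{0,π/2}` enters Grimmett–Manolescu's proof
(§8.3, Corollary (exp_transport1_cor), "apply the lemma twice"; §8.4).
[cite: GrimmettManolescu2014Isoradial, §8.3 Cor. (exp_transport1_cor) and §8.4 (proof of Prop. (exp_transport))] -/
theorem comparable_square_of_pairwise {k : ℕ} (κ : Fin k → Bool)
    (h : ∀ (ε : ℝ), 0 < ε → ∀ (I : ℕ), ∃ C > (0 : ℝ), ∃ c₀ : ℕ, 1 ≤ c₀ ∧ ∃ N₀ : ℕ,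
      ∀ (V F : Type) [Countable V] [DecidableEq V] [DecidableEq F] (G : SimpleGraph V)
        [G.LocallyFinite] (emb : RhombicEmbedding G F)
        (V' F' : Type) [Countable V'] [DecidableEq V'] [DecidableEq F'] (G' : SimpleGraph V')
        [G'.LocallyFinite] (emb' : RhombicEmbedding G' F'),
        G.Preconnected → emb.IsIsoradial → emb.IsRhombicTiling → emb.HasBoundedAngles ε →
        emb.SquareGridPropertyGM I → ((∃ v : V, emb.z v = 0) ∨ (∃ f : F, emb.c f = 0)) →
        G'.Preconnected → emb'.IsIsoradial → emb'.IsRhombicTiling → emb'.HasBoundedAngles ε →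
        emb'.SquareGridPropertyGM I → ((∃ v : V', emb'.z v = 0) ∨ (∃ f : F', emb'.c f = 0)) →
        ∀ N n : ℕ, N₀ ≤ N → c₀ * N ≤ n → emb.embArmProb κ N n ≤ C * emb'.embArmProb κ N n) :
    ∀ (ε : ℝ), 0 < ε → ∀ (I : ℕ), ∃ c₁ > (0 : ℝ), ∃ c₂ > (0 : ℝ), ∃ c₀ : ℕ, 1 ≤ c₀ ∧ ∃ N₀ : ℕ,
      ∀ (V F : Type) [Countable V] [DecidableEq V] [DecidableEq F] (G : SimpleGraph V)
        [G.LocallyFinite] (emb : RhombicEmbedding G F),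
        G.Preconnected → emb.IsIsoradial → emb.IsRhombicTiling → emb.HasBoundedAngles ε →
        emb.SquareGridPropertyGM I → ((∃ v : V, emb.z v = 0) ∨ (∃ f : F, emb.c f = 0)) →
        ∀ N n : ℕ, N₀ ≤ N → c₀ * N ≤ n →
          c₁ * squareLatticeEmbedding.embArmProb κ N n ≤ emb.embArmProb κ N n ∧
            emb.embArmProb κ N n ≤ c₂ * squareLatticeEmbedding.embArmProb κ N n := by
  intro ε hε I
  have hε' : 0 < min ε (Real.pi / 4) := lt_min hε (by positivity)
  obtain ⟨C, hC, c₀, hc₀, N₀, H⟩ := h (min ε (Real.pi / 4)) hε' (max I 1)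
  refine ⟨C⁻¹, inv_pos.2 hC, C, hC, c₀, hc₀, N₀, ?_⟩
  intro V F _ _ _ G _ emb hconn hiso hrh hbap hsgp h0 N n hN hn
  -- both `G` and the square lattice lie in the class `𝒢(ε ⊓ π/4, I ⊔ 1)`
  have hbap' : emb.HasBoundedAngles (min ε (Real.pi / 4)) := hbap.anti (min_le_left _ _)
  have hsgp' : emb.SquareGridPropertyGM (max I 1) := hsgp.mono (le_max_left _ _)
  have hsqbap : squareLatticeEmbedding.HasBoundedAngles (min ε (Real.pi / 4)) :=
    hasBoundedAngles_squareLatticeEmbedding_holds (min_le_right _ _)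
  have hsqsgp : squareLatticeEmbedding.SquareGridPropertyGM (max I 1) :=
    squareGridPropertyGM_squareLattice.mono (le_max_right _ _)
  have hsq0 : (∃ v : Site 2, squareLatticeEmbedding.z v = 0) ∨
      (∃ f : Site 2, squareLatticeEmbedding.c f = 0) := Or.inl ⟨0, squareLatticeEmbedding_z_zero⟩
  -- `P_{ℤ²} ≤ C · P_G` and `P_G ≤ C · P_{ℤ²}`
  have h1 := H (Site 2) (Site 2) (zdGraph 2) squareLatticeEmbedding V F G emb
    zdGraph_preconnected_holds isIsoradial_squareLatticeEmbedding_holds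
    isRhombicTiling_squareLatticeEmbedding_holds hsqbap hsqsgp hsq0 hconn hiso hrh hbap' hsgp' h0
    N n hN hn
  have h2 := H V F G emb (Site 2) (Site 2) (zdGraph 2) squareLatticeEmbedding hconn hiso hrh hbap'
    hsgp' h0 zdGraph_preconnected_holds isIsoradial_squareLatticeEmbedding_holds
    isRhombicTiling_squareLatticeEmbedding_holds hsqbap hsqsgp hsq0 N n hN hn
  refine ⟨?_, h2⟩
  rw [inv_mul_le_iff₀ hC]
  exact h1

/-- **The fact follows from pairwise comparability inside the classes `𝒢(ε, I)`** for the
one-arm and the two-arm events separately (constants depending on `k`, `ε`, `I`): the last two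
steps of Grimmett–Manolescu's proof of Prop. (exp_transport) in the tree's rendering — the
reference lattice is a member of the class (`comparable_square_of_pairwise`) and the constants for
`k = 1, 2` are merged (`of_oneArm_of_twoArm`). What remains to be supplied is the pairwise
comparability itself (§8.3 Lemma (exp_transport1), §8.4 Lemma (exp_transport2): the
star–triangle transport, on top of the box-crossing property of §3 and Prop. (exp_equiv)).
[cite: GrimmettManolescu2014Isoradial, §8.3–8.4 (structure of the proof of Prop. (exp_transport))] -/
theorem of_pairwise
    (h₁ : ∀ (ε : ℝ), 0 < ε → ∀ (I : ℕ), ∃ C > (0 : ℝ), ∃ c₀ : ℕ, 1 ≤ c₀ ∧ ∃ N₀ : ℕ,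
      ∀ (V F : Type) [Countable V] [DecidableEq V] [DecidableEq F] (G : SimpleGraph V)
        [G.LocallyFinite] (emb : RhombicEmbedding G F)
        (V' F' : Type) [Countable V'] [DecidableEq V'] [DecidableEq F'] (G' : SimpleGraph V')
        [G'.LocallyFinite] (emb' : RhombicEmbedding G' F'),
        G.Preconnected → emb.IsIsoradial → emb.IsRhombicTiling → emb.HasBoundedAngles ε →
        emb.SquareGridPropertyGM I → ((∃ v : V, emb.z v = 0) ∨ (∃ f : F, emb.c f = 0)) →
        G'.Preconnected → emb'.IsIsoradial → emb'.IsRhombicTiling → emb'.HasBoundedAngles ε →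
        emb'.SquareGridPropertyGM I → ((∃ v : V', emb'.z v = 0) ∨ (∃ f : F', emb'.c f = 0)) →
        ∀ N n : ℕ, N₀ ≤ N → c₀ * N ≤ n →
          emb.embArmProb oneArmColour N n ≤ C * emb'.embArmProb oneArmColour N n)
    (h₂ : ∀ (ε : ℝ), 0 < ε → ∀ (I : ℕ), ∃ C > (0 : ℝ), ∃ c₀ : ℕ, 1 ≤ c₀ ∧ ∃ N₀ : ℕ,
      ∀ (V F : Type) [Countable V] [DecidableEq V] [DecidableEq F] (G : SimpleGraph V)
        [G.LocallyFinite] (emb : RhombicEmbedding G F)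
        (V' F' : Type) [Countable V'] [DecidableEq V'] [DecidableEq F'] (G' : SimpleGraph V')
        [G'.LocallyFinite] (emb' : RhombicEmbedding G' F'),
        G.Preconnected → emb.IsIsoradial → emb.IsRhombicTiling → emb.HasBoundedAngles ε →
        emb.SquareGridPropertyGM I → ((∃ v : V, emb.z v = 0) ∨ (∃ f : F, emb.c f = 0)) →
        G'.Preconnected → emb'.IsIsoradial → emb'.IsRhombicTiling → emb'.HasBoundedAngles ε →
        emb'.SquareGridPropertyGM I → ((∃ v : V', emb'.z v = 0) ∨ (∃ f : F', emb'.c f = 0)) →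
        ∀ N n : ℕ, N₀ ≤ N → c₀ * N ≤ n →
          emb.embArmProb (alternatingColours 1) N n ≤
            C * emb'.embArmProb (alternatingColours 1) N n) :
    GrimmettManolescu2014_armComparability_one_two :=
  of_oneArm_of_twoArm (comparable_square_of_pairwise oneArmColour h₁)
    (comparable_square_of_pairwise (alternatingColours 1) h₂)

end GrimmettManolescu2014_armComparability_one_two

end Literature.Probability.Percolation

end
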